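import Literature.MathematicalPhysics.QuantumLattice.ReflectedCorrelationPolarisation
import Mathlib.Dynamics.Ergodic.MeasurePreserving
import Mathlib.Analysis.SpecialFunctions.Pow.Real
import HarnessLib

/-!
# Log-convexity (Hankel positivity) of reflection-positive autocorrelations

Sequel of `ReflectedCorrelationPolarisation` (abstract bookkeeping: a finite measure `μ` on `Ω`, a
measurable reflection `Θ`, a `μ`-preserving "time shift" `τ` with a measurable left inverse `σ`
intertwined by `τ ∘ Θ = Θ ∘ σ`). On a class `Good` of bounded measurable observables closed under
`X + c • Y` on which the OS form is positive (`0 ≤ osVar Z`, reflection positivity), the reflected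
autocorrelation `g(m) = osCorr μ Θ τ^m X X` of a good `X` whose shifts stay good satisfies

* `osCorr_id_conj_symm` — Hermitian symmetry of the OS form (from `Θ`-invariance of `μ`, `Θ² = 1`);
* `norm_osCorr_id_sq_le` — Cauchy–Schwarz `‖osCorr id X Y‖² ≤ osVar X · osVar Y` on the class;
* `osCorr_id_comp_comp` — the shift identity `osCorr id (X ∘ τ) (Y ∘ τ) = osCorr (τ ∘ τ) X Y`;
* `norm_osCorr_sq_le_osVar_mul_re` — ONE Hankel step `‖g(τ)‖² ≤ osVar X · Re g(τ ∘ τ)`;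
* **`norm_osCorr_iterate_pow_le`** — the dyadic iteration
  `‖g(m)‖^(2^J) ≤ (osVar X)^(2^J − 1) · ‖g(2^J m)‖`;
* **`norm_osCorr_iterate_le_of_decay`** — consequently ANY bound `‖g(2^J m)‖ ≤ C e^{−κ 2^J m}`
  (e.g. sup-norm exponential clustering at the far separation `2^J m`) gives the bound in OS
  currency at separation `m` up to the factor `(C / osVar X)^{2^{-J}}`:
  `‖g(m)‖ ≤ ((osVar X)^(2^J−1) · C)^{1/2^J} · e^{−κ m}`.

* `tendsto_pow_pred_mul_rpow_inv` — along a sequence, the prefactor `(V_k^(N_k−1) C_k)^{1/N_k}`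
  tends to `lim V_k` as soon as `N_k → ∞` and `log C_k / N_k → 0`.

This is the finite-range substitute for the spectral theorem of the transfer matrix: on a torus of
time extent `N` the steps are available while `2^J m` stays in the positive half, and the loss
factor tends to `1` when `2^{-J} log (C / osVar X) → 0` (physical volume large against the logarithm
of the sup-norm/OS-norm ratio). All statements here are proved.

References: K. Osterwalder, E. Seiler, Ann. Phys. 110 (1978) 440, §2 (reflection positivity,
transfer matrix); J. Glimm, A. Jaffe, Quantum Physics (1987), §6.1 (the form `⟨ΘF, T_t G⟩`,
Schwarz inequality) and §19.7; J. Fröhlich, R. Israel, E. H. Lieb, B. Simon, Commun. Math. Phys. 62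
(1978) 1, §2 (Schwarz inequality for RP states; log-convexity in the separation).
-/

open scoped ComplexConjugate
open Filter MeasureTheory

noncomputable section

namespace Literature.MathematicalPhysics.QuantumLattice

section LogConvex

variable {Ω : Type*} [MeasurableSpace Ω] {μ : Measure Ω} {Θ τ σ : Ω → Ω}

/-- Invariance of integrals under a measure-preserving map (no embedding hypothesis: the integrand
is measurable). [folklore] -/
theorem integral_comp_eq_of_measurePreserving (hτ : MeasurePreserving τ μ μ) {g : Ω → ℂ}
    (hg : Measurable g) : ∫ ω, g (τ ω) ∂μ = ∫ ω, g ω ∂μ := by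
  have h := integral_map hτ.measurable.aemeasurable (f := g)
    (hg.aestronglyMeasurable (μ := Measure.map τ μ))
  rw [hτ.map_eq] at h
  exact h.symm

/-- A shifted correlation is the unshifted correlation of the shifted observable:
`osCorr τ X Y = osCorr id X (Y ∘ τ)` when `τ` preserves `μ`. [folklore] -/
theorem osCorr_eq_osCorr_id_comp (hτ : MeasurePreserving τ μ μ) (X : Ω → ℂ) {Y : Ω → ℂ}
    (hY : Measurable Y) : osCorr μ Θ τ X Y = osCorr μ Θ id X (Y ∘ τ) := by
  unfold osCorr
  simp only [Function.comp_apply, id_eq]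
  rw [integral_comp_eq_of_measurePreserving hτ hY]

/-- **Hermitian symmetry of the OS form**: `osCorr id Y X = conj (osCorr id X Y)` when `μ` is
`Θ`-invariant and `Θ` is an involution. [cite: GlimmJaffe1987, §6.1] -/
theorem osCorr_id_conj_symm (hΘ : MeasurePreserving Θ μ μ) (hΘΘ : ∀ ω, Θ (Θ ω) = ω)
    {X Y : Ω → ℂ} (hX : Measurable X) (hY : Measurable Y) :
    osCorr μ Θ id Y X = conj (osCorr μ Θ id X Y) := by
  have h1 : ∫ ω, conj (Y (Θ ω)) * X ω ∂μ = ∫ ω, X (Θ ω) * conj (Y ω) ∂μ := by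
    have hg : Measurable fun ω => X (Θ ω) * conj (Y ω) :=
      (hX.comp hΘ.measurable).mul (Complex.continuous_conj.measurable.comp hY)
    rw [← integral_comp_eq_of_measurePreserving hΘ hg]
    refine integral_congr_ae (Eventually.of_forall fun ω => ?_)
    simp only [hΘΘ, mul_comm]
  have h2 : conj (∫ ω, conj (X (Θ ω)) * Y ω ∂μ) = ∫ ω, X (Θ ω) * conj (Y ω) ∂μ := by
    rw [← integral_conj]
    refine integral_congr_ae (Eventually.of_forall fun ω => ?_)
    simp only [map_mul, Complex.conj_conj]
  show (∫ ω, conj (Y (Θ ω)) * X ω ∂μ) - conj (∫ ω, Y ω ∂μ) * ∫ ω, X ω ∂μ =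
    conj ((∫ ω, conj (X (Θ ω)) * Y ω ∂μ) - conj (∫ ω, X ω ∂μ) * ∫ ω, Y ω ∂μ)
  rw [map_sub, map_mul, Complex.conj_conj, h2, h1, mul_comm (∫ ω, X ω ∂μ)]

/-- **The shift identity**: for a `μ`-preserving shift `τ` with measurable left inverse `σ`
intertwined with the reflection by `τ ∘ Θ = Θ ∘ σ` (on a lattice: shifting forward after
reflecting is reflecting after shifting backward),
`osCorr id (X ∘ τ) (Y ∘ τ) = osCorr (τ ∘ τ) X Y` — the OS Gram matrix of the shifts of one
observable is a Hankel matrix in the separation. [cite: OsterwalderSeiler1978, §2] -/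
theorem osCorr_id_comp_comp (hτ : MeasurePreserving τ μ μ) (hσ : Measurable σ)
    (hΘ : Measurable Θ) (hΘτ : ∀ ω, τ (Θ ω) = Θ (σ ω)) (hστ : ∀ ω, σ (τ ω) = ω)
    {X Y : Ω → ℂ} (hX : Measurable X) (hY : Measurable Y) :
    osCorr μ Θ id (X ∘ τ) (Y ∘ τ) = osCorr μ Θ (τ ∘ τ) X Y := by
  unfold osCorr
  simp only [Function.comp_apply, id_eq]
  rw [integral_comp_eq_of_measurePreserving hτ hX, integral_comp_eq_of_measurePreserving hτ hY]
  congr 1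
  have hg : Measurable fun ω => conj (X (Θ (σ ω))) * Y (τ ω) :=
    (Complex.continuous_conj.measurable.comp (hX.comp (hΘ.comp hσ))).mul (hY.comp hτ.measurable)
  have h := integral_comp_eq_of_measurePreserving hτ hg
  simp only [hστ] at h
  rw [h]
  refine integral_congr_ae (Eventually.of_forall fun ω => ?_)
  simp only [hΘτ]

/-- The diagonal of the OS form is real on a Hermitian form: `osCorr id X X = osVar X`. [folklore] -/
theorem osCorr_id_self_eq_osVar (hΘ : MeasurePreserving Θ μ μ) (hΘΘ : ∀ ω, Θ (Θ ω) = ω)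
    {X : Ω → ℂ} (hX : Measurable X) : osCorr μ Θ id X X = (osVar μ Θ X : ℂ) := by
  have h := osCorr_id_conj_symm hΘ hΘΘ hX hX
  unfold osVar
  exact (Complex.conj_eq_iff_re.1 h.symm).symm

variable [IsFiniteMeasure μ]

/-- **Cauchy–Schwarz for the OS form on a reflection-positive class.** On a class `Good` of bounded
measurable functions closed under `X + c • Y` with `0 ≤ osVar Z` for good `Z` (reflection
positivity), `‖osCorr id X Y‖² ≤ osVar X · osVar Y` for good `X, Y`. [cite: GlimmJaffe1987, §6.1] -/
theorem norm_osCorr_id_sq_le (hΘm : Measurable Θ) (hΘ : MeasurePreserving Θ μ μ)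
    (hΘΘ : ∀ ω, Θ (Θ ω) = ω) {Good : (Ω → ℂ) → Prop} (hmeas : ∀ X, Good X → Measurable X)
    (hbdd : ∀ X, Good X → ∃ B, ∀ ω, ‖X ω‖ ≤ B)
    (hadd : ∀ X Y (c : ℂ), Good X → Good Y → Good (X + c • Y))
    (hvar : ∀ Z, Good Z → 0 ≤ osVar μ Θ Z) {X Y : Ω → ℂ} (hX : Good X) (hY : Good Y) :
    ‖osCorr μ Θ id X Y‖ ^ 2 ≤ osVar μ Θ X * osVar μ Θ Y := by
  have hXm := hmeas X hX
  have hYm := hmeas Y hY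
  set A : ℂ := osCorr μ Θ id X Y with hA
  have hsymm : osCorr μ Θ id Y X = conj A := osCorr_id_conj_symm hΘ hΘΘ hXm hYm
  have hXX : osCorr μ Θ id X X = (osVar μ Θ X : ℂ) := osCorr_id_self_eq_osVar hΘ hΘΘ hXm
  have hYY : osCorr μ Θ id Y Y = (osVar μ Θ Y : ℂ) := osCorr_id_self_eq_osVar hΘ hΘΘ hYm
  -- the quadratic polynomial `t ↦ osVar X + 2 t ‖A‖² + t² ‖A‖² osVar Y` is nonnegative
  have hquad : ∀ t : ℝ, 0 ≤ osVar μ Θ X + 2 * t * ‖A‖ ^ 2 + t ^ 2 * (‖A‖ ^ 2 * osVar μ Θ Y) := by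
    intro t
    have h0 := hvar _ (hadd X Y ((t : ℂ) * conj A) hX hY)
    unfold osVar at h0
    rw [osCorr_add_smul hΘm measurable_id hXm (hbdd X hX) hYm (hbdd Y hY), hsymm, hXX, hYY] at h0
    have e : ((osVar μ Θ X : ℂ) + (t : ℂ) * conj A * A + conj ((t : ℂ) * conj A) * conj A +
        conj ((t : ℂ) * conj A) * ((t : ℂ) * conj A) * (osVar μ Θ Y : ℂ)).re =
        osVar μ Θ X + 2 * t * ‖A‖ ^ 2 + t ^ 2 * (‖A‖ ^ 2 * osVar μ Θ Y) := by
      have h1 : conj A * A = ((‖A‖ ^ 2 : ℝ) : ℂ) := by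
        rw [Complex.conj_mul', ← Complex.ofReal_pow]
      simp only [map_mul, Complex.conj_ofReal, Complex.conj_conj]
      have h2 : (t : ℂ) * conj A * A = ((t * ‖A‖ ^ 2 : ℝ) : ℂ) := by
        rw [mul_assoc, h1]; push_cast; ring
      have h3 : (t : ℂ) * A * conj A = ((t * ‖A‖ ^ 2 : ℝ) : ℂ) := by
        rw [mul_assoc, mul_comm A, h1]; push_cast; ring
      have h4 : (t : ℂ) * A * ((t : ℂ) * conj A) * (osVar μ Θ Y : ℂ) =
          ((t ^ 2 * (‖A‖ ^ 2 * osVar μ Θ Y) : ℝ) : ℂ) := by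
        have : (t : ℂ) * A * ((t : ℂ) * conj A) = (t : ℂ) * (t : ℂ) * (conj A * A) := by ring
        rw [this, h1]; push_cast; ring
      rw [h2, h3, h4]
      simp only [Complex.add_re, Complex.ofReal_re]
      ring
    rw [e] at h0
    exact h0
  -- discriminant argument
  by_cases hA0 : ‖A‖ = 0
  · rw [hA0]; simp only [ne_eq, OfNat.ofNat_ne_zero, not_false_eq_true, zero_pow]
    exact mul_nonneg (hvar X hX) (hvar Y hY)
  have hApos : 0 < ‖A‖ ^ 2 := by positivity
  have hVY : 0 ≤ osVar μ Θ Y := hvar Y hY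
  by_cases hVY0 : osVar μ Θ Y = 0
  · -- linear polynomial nonnegative for all t forces ‖A‖ = 0: contradiction
    exfalso
    have h := hquad (-(osVar μ Θ X + 1) / (2 * ‖A‖ ^ 2))
    rw [hVY0, mul_zero, mul_zero, add_zero] at h
    have : 2 * (-(osVar μ Θ X + 1) / (2 * ‖A‖ ^ 2)) * ‖A‖ ^ 2 = -(osVar μ Θ X + 1) := by
      field_simp
    rw [this] at h
    linarith
  have hVYpos : 0 < osVar μ Θ Y := lt_of_le_of_ne hVY (Ne.symm hVY0)
  have h := hquad (-1 / osVar μ Θ Y)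
  have e : osVar μ Θ X + 2 * (-1 / osVar μ Θ Y) * ‖A‖ ^ 2 +
      (-1 / osVar μ Θ Y) ^ 2 * (‖A‖ ^ 2 * osVar μ Θ Y) = osVar μ Θ X - ‖A‖ ^ 2 / osVar μ Θ Y := by
    field_simp
    ring
  rw [e] at h
  rw [← sub_nonneg]
  have : osVar μ Θ X * osVar μ Θ Y - ‖A‖ ^ 2 = (osVar μ Θ X - ‖A‖ ^ 2 / osVar μ Θ Y) * osVar μ Θ Y := by
    field_simp
  rw [this]
  exact mul_nonneg h hVY

/-- **One Hankel step.** If `X` and its shift `X ∘ τ` are good, then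
`‖osCorr τ X X‖² ≤ osVar X · Re (osCorr (τ ∘ τ) X X)`: Cauchy–Schwarz for the pair `(X, X ∘ τ)`
and the shift identity `osVar (X ∘ τ) = Re osCorr (τ ∘ τ) X X`. [cite: GlimmJaffe1987, §6.1] -/
theorem norm_osCorr_sq_le_osVar_mul_re (hΘm : Measurable Θ) (hΘ : MeasurePreserving Θ μ μ)
    (hΘΘ : ∀ ω, Θ (Θ ω) = ω) (hτ : MeasurePreserving τ μ μ) (hσ : Measurable σ)
    (hΘτ : ∀ ω, τ (Θ ω) = Θ (σ ω)) (hστ : ∀ ω, σ (τ ω) = ω)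
    {Good : (Ω → ℂ) → Prop} (hmeas : ∀ X, Good X → Measurable X)
    (hbdd : ∀ X, Good X → ∃ B, ∀ ω, ‖X ω‖ ≤ B)
    (hadd : ∀ X Y (c : ℂ), Good X → Good Y → Good (X + c • Y))
    (hvar : ∀ Z, Good Z → 0 ≤ osVar μ Θ Z) {X : Ω → ℂ} (hX : Good X) (hXτ : Good (X ∘ τ)) :
    ‖osCorr μ Θ τ X X‖ ^ 2 ≤ osVar μ Θ X * (osCorr μ Θ (τ ∘ τ) X X).re := by
  have hXm := hmeas X hX
  rw [osCorr_eq_osCorr_id_comp hτ X hXm]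
  refine (norm_osCorr_id_sq_le hΘm hΘ hΘΘ hmeas hbdd hadd hvar hX hXτ).trans (le_of_eq ?_)
  congr 1
  unfold osVar
  rw [osCorr_id_comp_comp hτ hσ hΘm hΘτ hστ hXm hXm]

omit [MeasurableSpace Ω] in
/-- Iterates of an intertwined pair `(τ, σ)` are intertwined. [folklore] -/
theorem iterate_apply_reflect (hΘτ : ∀ ω, τ (Θ ω) = Θ (σ ω)) (n : ℕ) (ω : Ω) :
    τ^[n] (Θ ω) = Θ (σ^[n] ω) := by
  induction n generalizing ω with
  | zero => rfl
  | succ n ih =>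
    rw [Function.iterate_succ_apply, Function.iterate_succ_apply, hΘτ, ih]

omit [MeasurableSpace Ω] in
/-- Iterates of a left inverse are left inverses of the iterates. [folklore] -/
theorem iterate_leftInverse (hστ : ∀ ω, σ (τ ω) = ω) (n : ℕ) (ω : Ω) :
    σ^[n] (τ^[n] ω) = ω := by
  induction n generalizing ω with
  | zero => rfl
  | succ n ih =>
    rw [Function.iterate_succ_apply σ, Function.iterate_succ_apply' τ, hστ, ih]

/-- **Dyadic Hankel iteration (log-convexity of reflection-positive autocorrelations).** If `X`
and its shifts `X ∘ τ^(2^j m)` (`j ≤ J`) are good, then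
`‖osCorr τ^m X X‖^(2^J) ≤ (osVar X)^(2^J − 1) · ‖osCorr τ^(2^J m) X X‖`.
On a lattice this interpolates the OS-currency decay of the autocorrelation between separation `0`
(the OS variance) and ANY bound available at the far separation `2^J m` — the finite-range
substitute for the spectral theorem of the transfer matrix. [cite: FrohlichIsraelLiebSimon1978, §2] -/
theorem norm_osCorr_iterate_pow_le (hΘm : Measurable Θ) (hΘ : MeasurePreserving Θ μ μ)
    (hΘΘ : ∀ ω, Θ (Θ ω) = ω) (hτ : MeasurePreserving τ μ μ) (hσ : Measurable σ)
    (hΘτ : ∀ ω, τ (Θ ω) = Θ (σ ω)) (hστ : ∀ ω, σ (τ ω) = ω)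
    {Good : (Ω → ℂ) → Prop} (hmeas : ∀ X, Good X → Measurable X)
    (hbdd : ∀ X, Good X → ∃ B, ∀ ω, ‖X ω‖ ≤ B)
    (hadd : ∀ X Y (c : ℂ), Good X → Good Y → Good (X + c • Y))
    (hvar : ∀ Z, Good Z → 0 ≤ osVar μ Θ Z) {X : Ω → ℂ} (hX : Good X) (J : ℕ) :
    ∀ m : ℕ, (∀ j ≤ J, Good (X ∘ τ^[2 ^ j * m])) →
      ‖osCorr μ Θ (τ^[m]) X X‖ ^ (2 ^ J) ≤
        osVar μ Θ X ^ (2 ^ J - 1) * ‖osCorr μ Θ (τ^[2 ^ J * m]) X X‖ := by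
  induction J with
  | zero => intro m _; simp
  | succ J ih =>
    intro m hgood
    have hV : 0 ≤ osVar μ Θ X := hvar X hX
    -- one step at shift `τ^[m]` with partner `σ^[m]`
    have h1 : ‖osCorr μ Θ (τ^[m]) X X‖ ^ 2 ≤
        osVar μ Θ X * ‖osCorr μ Θ (τ^[2 * m]) X X‖ := by
      have hstep := norm_osCorr_sq_le_osVar_mul_re hΘm hΘ hΘΘ (hτ.iterate m) (hσ.iterate m)
        (iterate_apply_reflect hΘτ m) (iterate_leftInverse hστ m) hmeas hbdd hadd hvar hX
        (by simpa using hgood 0 (Nat.zero_le _))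
      have hcomp : (τ^[m]) ∘ (τ^[m]) = τ^[2 * m] := by
        rw [← Function.iterate_add, two_mul]
      rw [hcomp] at hstep
      exact hstep.trans (mul_le_mul_of_nonneg_left (Complex.re_le_norm _) hV)
    -- induction hypothesis at shift `2 m`
    have h2 := ih (2 * m) (fun j hj => by
      have := hgood (j + 1) (by omega)
      rwa [pow_succ, mul_assoc] at this)
    have hmul : 2 ^ J * (2 * m) = 2 ^ (J + 1) * m := by ring
    rw [hmul] at h2
    calc ‖osCorr μ Θ (τ^[m]) X X‖ ^ 2 ^ (J + 1)
        = (‖osCorr μ Θ (τ^[m]) X X‖ ^ 2) ^ 2 ^ J := by rw [← pow_mul, pow_succ']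
      _ ≤ (osVar μ Θ X * ‖osCorr μ Θ (τ^[2 * m]) X X‖) ^ 2 ^ J :=
          pow_le_pow_left₀ (by positivity) h1 _
      _ = osVar μ Θ X ^ 2 ^ J * ‖osCorr μ Θ (τ^[2 * m]) X X‖ ^ 2 ^ J := mul_pow _ _ _
      _ ≤ osVar μ Θ X ^ 2 ^ J * (osVar μ Θ X ^ (2 ^ J - 1) *
            ‖osCorr μ Θ (τ^[2 ^ (J + 1) * m]) X X‖) :=
          mul_le_mul_of_nonneg_left h2 (by positivity)
      _ = osVar μ Θ X ^ (2 ^ (J + 1) - 1) * ‖osCorr μ Θ (τ^[2 ^ (J + 1) * m]) X X‖ := by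
          rw [← mul_assoc, ← pow_add]
          congr 2
          have : 1 ≤ 2 ^ J := Nat.one_le_two_pow
          rw [pow_succ]; omega

/-- **OS-currency decay from far-separation decay.** Under the hypotheses of
`norm_osCorr_iterate_pow_le`, ANY bound `‖osCorr τ^(2^J m) X X‖ ≤ C e^{−κ 2^J m}` at the far
separation (e.g. sup-norm exponential clustering) gives, at separation `m`,
`‖osCorr τ^m X X‖ ≤ ((osVar X)^(2^J − 1) · C)^{1/2^J} · e^{−κ m}` — the OS variance up to the loss
factor `(C / osVar X)^{2^{-J}}`, at the SAME rate `κ`. [cite: FrohlichIsraelLiebSimon1978, §2] -/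
theorem norm_osCorr_iterate_le_of_decay (hΘm : Measurable Θ) (hΘ : MeasurePreserving Θ μ μ)
    (hΘΘ : ∀ ω, Θ (Θ ω) = ω) (hτ : MeasurePreserving τ μ μ) (hσ : Measurable σ)
    (hΘτ : ∀ ω, τ (Θ ω) = Θ (σ ω)) (hστ : ∀ ω, σ (τ ω) = ω)
    {Good : (Ω → ℂ) → Prop} (hmeas : ∀ X, Good X → Measurable X)
    (hbdd : ∀ X, Good X → ∃ B, ∀ ω, ‖X ω‖ ≤ B)
    (hadd : ∀ X Y (c : ℂ), Good X → Good Y → Good (X + c • Y))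
    (hvar : ∀ Z, Good Z → 0 ≤ osVar μ Θ Z) {X : Ω → ℂ} (hX : Good X) {J m : ℕ}
    (hgood : ∀ j ≤ J, Good (X ∘ τ^[2 ^ j * m])) {C κ : ℝ}
    (hfar : ‖osCorr μ Θ (τ^[2 ^ J * m]) X X‖ ≤ C * Real.exp (-(κ * (2 ^ J * m)))) :
    ‖osCorr μ Θ (τ^[m]) X X‖ ≤
      (osVar μ Θ X ^ (2 ^ J - 1) * C) ^ ((2 ^ J : ℝ)⁻¹) * Real.exp (-(κ * m)) := by
  have hV : 0 ≤ osVar μ Θ X := hvar X hX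
  have hN : (2 ^ J : ℕ) ≠ 0 := by positivity
  have hiter := norm_osCorr_iterate_pow_le hΘm hΘ hΘΘ hτ hσ hΘτ hστ hmeas hbdd hadd hvar hX J m
    hgood
  -- `‖g(m)‖^N ≤ V^(N-1) C e^{-κ N m} = (V^(N-1) C) (e^{-κ m})^N`
  have hexp : Real.exp (-(κ * (2 ^ J * m))) = Real.exp (-(κ * m)) ^ (2 ^ J : ℕ) := by
    rw [← Real.exp_nat_mul]; congr 1; push_cast; ring
  have hmain : ‖osCorr μ Θ (τ^[m]) X X‖ ^ (2 ^ J : ℕ) ≤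
      (osVar μ Θ X ^ (2 ^ J - 1) * C) * Real.exp (-(κ * m)) ^ (2 ^ J : ℕ) := by
    refine hiter.trans ?_
    rw [mul_assoc]
    refine mul_le_mul_of_nonneg_left ?_ (by positivity)
    rw [← hexp]; exact hfar
  -- divide by the positive `e^{-κ m}` power and extract the root
  have hE : 0 < Real.exp (-(κ * m)) := Real.exp_pos _
  have hq : (‖osCorr μ Θ (τ^[m]) X X‖ / Real.exp (-(κ * m))) ^ (2 ^ J : ℕ) ≤
      osVar μ Θ X ^ (2 ^ J - 1) * C := by
    rw [div_pow, div_le_iff₀ (by positivity)]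
    exact hmain
  -- root extraction (as in `Literature.NumberTheory.Sieve.Teravainen2024.le_rpow_inv_of_pow_le`)
  have hx : 0 ≤ ‖osCorr μ Θ (τ^[m]) X X‖ / Real.exp (-(κ * m)) := div_nonneg (norm_nonneg _) hE.le
  have hroot : ‖osCorr μ Θ (τ^[m]) X X‖ / Real.exp (-(κ * m)) ≤
      (osVar μ Θ X ^ (2 ^ J - 1) * C) ^ ((2 ^ J : ℝ)⁻¹) := by
    have h1 : ((‖osCorr μ Θ (τ^[m]) X X‖ / Real.exp (-(κ * m))) ^ (2 ^ J : ℕ)) ^ (((2 ^ J : ℕ) : ℝ)⁻¹)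
        ≤ (osVar μ Θ X ^ (2 ^ J - 1) * C) ^ (((2 ^ J : ℕ) : ℝ)⁻¹) :=
      Real.rpow_le_rpow (pow_nonneg hx _) hq (by positivity)
    rw [Real.pow_rpow_inv_natCast hx hN] at h1
    simpa using h1
  rw [div_le_iff₀ hE] at hroot
  simpa using hroot

end LogConvex


section LossFactor

/-! ## The loss factor along a sequence of tori

Along a sequence of lattices `k` (OS variances `V_k → v`, far-separation constants `C_k`, numbers
of available dyadic steps `N_k = 2^{J_k} → ∞`) the bound of `norm_osCorr_iterate_le_of_decay` is
`(V_k^{N_k - 1} C_k)^{1/N_k} e^{-κ m}`; its prefactor tends to the limiting OS variance `v` exactly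
when `log C_k / N_k → 0` — on a torus of physical time extent `ℓ_k` with sup-norm constants
polynomial in the inverse lattice spacing, when `ℓ_k / log(1/a_k) → ∞`. -/

/-- **The loss factor disappears in the limit**: if `0 ≤ V_k → v`, `N_k → ∞`, `C_k > 0` and
`log C_k / N_k → 0`, then `(V_k^{N_k − 1} C_k)^{1/N_k} → v`. [folklore] -/
theorem tendsto_pow_pred_mul_rpow_inv {V C : ℕ → ℝ} {N : ℕ → ℕ} {v : ℝ}
    (hV : ∀ k, 0 ≤ V k) (hVt : Tendsto V atTop (nhds v)) (hN : Tendsto N atTop atTop)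
    (hC : ∀ k, 0 < C k) (hCt : Tendsto (fun k => Real.log (C k) / N k) atTop (nhds 0)) :
    Tendsto (fun k => (V k ^ (N k - 1) * C k) ^ ((N k : ℝ)⁻¹)) atTop (nhds v) := by
  have hN1 : ∀ᶠ k in atTop, 1 ≤ N k := hN.eventually_ge_atTop 1
  -- eventually the prefactor is `V_k ^ (1 - 1/N_k) * exp (log C_k / N_k)`
  have heq : (fun k => V k ^ (1 - (N k : ℝ)⁻¹) * Real.exp (Real.log (C k) / N k)) =ᶠ[atTop]
      fun k => (V k ^ (N k - 1) * C k) ^ ((N k : ℝ)⁻¹) := by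
    filter_upwards [hN1] with k hk
    have hNk : (N k : ℝ) ≠ 0 := by exact_mod_cast (by omega : N k ≠ 0)
    rw [Real.mul_rpow (pow_nonneg (hV k) _) (hC k).le]
    congr 1
    · rw [← Real.rpow_natCast, ← Real.rpow_mul (hV k)]
      congr 1
      rw [Nat.cast_sub hk, Nat.cast_one, sub_mul, mul_inv_cancel₀ hNk, one_mul]
    · rw [Real.rpow_def_of_pos (hC k), div_eq_mul_inv]
  refine Tendsto.congr' heq ?_
  -- exponent `1 - 1/N_k → 1`
  have hexp : Tendsto (fun k => 1 - (N k : ℝ)⁻¹) atTop (nhds 1) := by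
    have h : Tendsto (fun k => (N k : ℝ)⁻¹) atTop (nhds 0) :=
      tendsto_inv_atTop_zero.comp (tendsto_natCast_atTop_atTop.comp hN)
    simpa using (tendsto_const_nhds (x := (1 : ℝ))).sub h
  -- first factor `→ v ^ 1 = v` (continuity of `rpow` at `(v, 1)`, valid also at `v = 0`)
  have h1 : Tendsto (fun k => V k ^ (1 - (N k : ℝ)⁻¹)) atTop (nhds v) := by
    have h := hVt.rpow hexp (Or.inr one_pos)
    simpa [Real.rpow_one] using h
  -- second factor `→ exp 0 = 1`
  have h2 : Tendsto (fun k => Real.exp (Real.log (C k) / N k)) atTop (nhds 1) := by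
    have h := (Real.continuous_exp.tendsto 0).comp hCt
    rw [Real.exp_zero] at h
    exact h
  simpa using h1.mul h2

end LossFactor

end Literature.MathematicalPhysics.QuantumLattice

end
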